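import Summits.QuantumFields.YangMills.Theorems.FluctuationComparisonRegPrIntLS2BetaCovariantOscillationTower
import Summits.QuantumFields.YangMills.Theorems.FluctuationComparisonRegPrIntLS2BetaCovariantOscillationFeed
import HarnessLib

/-!
# S2β · (REG-UP)′ «THE K-UNIFORM ROAD (PROP-4 ROAD), ASSEMBLED MODULO ITS DISPLAYED LETTERS»: the covariant oscillation of the level-`l` datum from the COMPOSITE linearised map
# `D = DΨ_l(0)` in ONE stroke — `O_l ≤ 2·(d·3L)·(β + Λ·ℓ·c₀ + 2ρ₂)` — so that with the K-uniform sup row `Λ = C·L^l` ([Balaban1985Averaging] Prop. 4 (130); tree ✓(D2) `‖DΨ_k(0)X‖ ≤ (1+4(d+2))e^{c₃Σα}L^k‖X‖`)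
# and `ℓ = L^l` the profile is `C·L^{2l}·c₀` with a constant INDEPENDENT OF THE NUMBER OF LEVELS (FINDING «(REG-UP) K-UNIFORMITY» 2026-09-01T02:02Z; desk №712: (REG-UP)′ holder px13)

Cell `ym3-torus` (YM ladder rung R3 = continuum `SU(2)` Yang–Mills on the three-torus at fixed lattice data — a RUNG: NOT d = 4, NOT infinite volume, NOT a mass gap,
NOT Clay).  Width seat `ym3-torus-px13` (gen 29); crux `stmt-QuantumFields-20520`, LINE g18-1 S2β, node (REG-UP)′.  `--kind proof --supports stmt-QuantumFields-20520 --as helper`,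
count-neutral, DEFINITION-FREE (0 `def`, 0 `instance`, 0 `notation`, 0 `sorry`, default heartbeats).  Torus side, `SU(N)`, a fine level `j` and a coarse level `l` (any two levels).

WHY (the honest limit of ✓p839850 `hOSC_tower`).  Iterating a one-step oscillation transport re-pays the comb words at every level (`cs (i+1) ≥ 3W(W+1+L)·cs i`, `≈ 107·L²` per level at
d = 3): true, but not K-uniform in the sense (V4) ✓p840010's `ha` needs.  Print's K-uniformity is Prop. 4 (130): the COMPOSITE linearised average has sup row `≤ 2·Lˡ` UNIFORMLY in `l`.
This file is the road that uses the composite ONCE: no induction on levels, hence no compounding.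

THE DISPLAYED LETTERS (all HYPOTHESES here; their holders named).  `D : (PBond P j → M_N) → (PBond P l → M_N)` the composite linearised map at the background (abstract):
(hDlin) `D (Y − Y′) = D Y − D Y′` [✓ `fderiv` is linear]; (hD) SUP ROW `‖D Y c̄‖ ≤ Λ·sup‖Y‖` [✓(D2) px12∕px13 g25 lineage `…ChartReadDerivKStepSup*`: `Λ = (1+4(d+2))e^{c₃Σα}·L^l`, K-uniform;
19200 lane ✓`norm_QTwS_apply_le_of_regPr`: `30·L^{K−n}`]; (hDcov) THE COVARIANT-TRANSLATION LETTER — for every coarse step `(ȳ, μ)` there is a fine datum `Y′` within `ℓ·c₀` of `X₀` bondwise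
(the datum transported back along the `L^l`-step straight fine word: `ℓ = L^l`, `c₀` = the fine word-oscillation, ✓p839768) such that transporting `(D X₀)` across the coarse bond `⟨ȳ,μ⟩` by
the coarse background lands within `β` of `D Y′` at `ȳ` [translation-equivariance of the averaging + background-Lipschitz of `D` + the `Ū`-vs-line defect: px12 g27 (O2-a)(O2-b), M;
`β` = BKG×size class]; (hNL) the second-order sup letter `‖X_l c̄ − (D X₀) c̄‖ ≤ ρ₂` [the rows' per-level remainders summed geometrically; (D1)∕C₆∕C₇ lineage].

WHAT IS PROVED (sorry-free).  §1 ★`step_of_compositeLetters` — ONE COARSE STEP: `‖↑(Ū⟨ȳ,μ⟩)·(D X₀)⟨ȳ+e_μ,κ⟩·↑(Ū⟨ȳ,μ⟩)⋆ − (D X₀)⟨ȳ,κ⟩‖ ≤ β + Λ·(ℓ·c₀)`.  §2 ★★`wordOsc_of_compositeLetters`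
(`≤ |w̄|·(β + Λ·ℓ·c₀)`, ✓p839768 `wordOsc_of_step`) and ★★`wordOsc_datum_of_compositeLetters` (`X_l`: `+ 2ρ₂`, ✓p839886 `wordOsc_of_approx`).  §3 ★★★`hOSC_of_compositeLetters` — C₇b
✓p838589's `hOSC` LEFT SIDE at level `l` (`l + 2 ≤ m + K`) `≤ 2·(d·3L)·(β + Λ·(ℓ·c₀) + 2ρ₂)` (✓p839850 §1 bridge + ✓p839541 §3) — with `Λ = C·L^l`, `ℓ = L^l`: **`O_l = 2(d·3L)·(C·L^{2l}·c₀ + β + 2ρ₂)`**,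
the (F1)∕V4 profile with a level-independent constant.

TARGET PROFILES (architect px17 g23 02:19:44Z condition, for (V4) ✓p840010's `ha : a(i+1) ≤ A·L^{−2(t+1)}` to follow by bookkeeping alone): at level `l` the three displayed
reals are to be inhabited with `Λ·(ℓ·c₀) = C·L^{2l}·c₀`, `c₀ = η²·B₁(α₀+α₁)` ((R-3)), and **`β ≤ const·L^{2l}·η²`** (BKG×size: the background's plaquette class `∝ (Lˡη)²` times the
datum's size `∝ Lˡη·s`, one more `Lˡη ≤ 1`), **`ρ₂ ≤ const·L^{2l}·η²`** (quadratic: `(Lˡ·η·s)²`); then `O_l ≤ const·L^{2l}·η² = const·L^{−2(t+1)}` at co-level `t + 1 = (K−J) − l`, the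
constant independent of `l`, `K`, `J`.

HONEST.  Assembly over landed plumbing; EVERY analytic input is a displayed binder with a named holder (the point of this file is the exact gap list, rc 0); nothing of Bałaban's analysis is
proved ([Balaban1985Averaging] Prop. 3∕4 (121)–(135) are the printed loci of (hD)∕(hDcov)∕(hNL)); (hDcov) in particular is NOT yet on the tree; GAP♯∘ (registry 3732b7df UNTOUCHED, 0∕5),
S2β, crux 20520, 19936, 19200, `YM3TorusSU2` — NOT proved; rung R3 — NOT d = 4, NOT infinite volume, NOT a mass gap, NOT Clay; the Yang–Mills mass gap is NOT proved.
-/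

set_option autoImplicit false

noncomputable section

open scoped Matrix.Norms.L2Operator

namespace Summit.QuantumFields.YangMills.Theorems.FluctuationComparisonRegPrIntLS2BetaCovariantOscillationKUniform

open Literature.MathematicalPhysics.QuantumFieldTheory.Balaban1983to89
open T4Continuum (walk walkEnd holAt Letter)
open HaarExponentialChart
open T4AxialGaugeSmallField (axialGauge)
open Summit.QuantumFields.YangMills.Theorems.FluctuationComparisonRegPrIntLS2BetaCovWalkSumStokes (norm_coe_conj_le)
open Summit.QuantumFields.YangMills.Theorems.FluctuationComparisonRegPrIntLS2BetaCovariantOscillationWalkSums (wordOsc_of_step)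
open Summit.QuantumFields.YangMills.Theorems.FluctuationComparisonRegPrIntLS2BetaCovariantOscillationFeed (wordOsc_of_approx)
open Summit.QuantumFields.YangMills.Theorems.FluctuationComparisonRegPrIntLS2BetaCovariantOscillationTower (zdWordOsc_of_torusWordOsc)
open Summit.QuantumFields.YangMills.Theorems.FluctuationComparisonRegPrIntLS2BetaCovariantOscillationCornerBox (hOSC_of_wordOscillation)

variable {P : Params} {j l N : ℕ} [NeZero N]

/-! ## §1 One coarse step from the composite letters -/

section Step

omit [NeZero N] in
/-- ★ **ONE COARSE STEP FROM THE COMPOSITE LETTERS**: linearity (hDlin), the sup row `Λ` (hD) and the covariant-translation letter (hDcov: across the coarse bond `⟨ȳ,μ⟩` the transported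
`D X₀` is within `β` of `D Y′` for SOME fine datum `Y′` within `ℓ·c₀` of `X₀`) give `‖↑(Ū⟨ȳ,μ⟩)·(D X₀)⟨ȳ+e_μ,κ⟩·↑(Ū⟨ȳ,μ⟩)⋆ − (D X₀)⟨ȳ,κ⟩‖ ≤ β + Λ·(ℓ·c₀)` — the composite used ONCE.
[cite: Balaban1985Averaging, Prop. 4 (128)-(131) pp.37-38, (124)-(125) p.36] -/
theorem step_of_compositeLetters (Ubar : GaugeField P l (Matrix.specialUnitaryGroup (Fin N) ℂ))
    (D : (PBond P j → Matrix (Fin N) (Fin N) ℂ) → (PBond P l → Matrix (Fin N) (Fin N) ℂ)) (X₀ : PBond P j → Matrix (Fin N) (Fin N) ℂ) {Λ β ℓ c₀ : ℝ}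
    (hDlin : ∀ Y Y' : PBond P j → Matrix (Fin N) (Fin N) ℂ, D (fun b => Y b - Y' b) = fun c => D Y c - D Y' c)
    (hD : ∀ (Y : PBond P j → Matrix (Fin N) (Fin N) ℂ) (s : ℝ), (∀ b, ‖Y b‖ ≤ s) → ∀ c, ‖D Y c‖ ≤ Λ * s)
    (hDcov : ∀ (y : Site P l) (μ : Fin P.d), ∃ Y' : PBond P j → Matrix (Fin N) (Fin N) ℂ, (∀ b, ‖Y' b - X₀ b‖ ≤ ℓ * c₀) ∧
      ∀ κ : Fin P.d, ‖((Ubar ⟨y, μ⟩ : Matrix.specialUnitaryGroup (Fin N) ℂ) : Matrix (Fin N) (Fin N) ℂ) * D X₀ ⟨y.shift μ, κ⟩ *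
          star ((Ubar ⟨y, μ⟩ : Matrix.specialUnitaryGroup (Fin N) ℂ) : Matrix (Fin N) (Fin N) ℂ) - D Y' ⟨y, κ⟩‖ ≤ β)
    (y : Site P l) (μ κ : Fin P.d) :
    ‖((Ubar ⟨y, μ⟩ : Matrix.specialUnitaryGroup (Fin N) ℂ) : Matrix (Fin N) (Fin N) ℂ) * D X₀ ⟨y.shift μ, κ⟩ *
        star ((Ubar ⟨y, μ⟩ : Matrix.specialUnitaryGroup (Fin N) ℂ) : Matrix (Fin N) (Fin N) ℂ) - D X₀ ⟨y, κ⟩‖ ≤ β + Λ * (ℓ * c₀) := by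
  obtain ⟨Y', hY', hcov⟩ := hDcov y μ
  have hlin : D Y' ⟨y, κ⟩ - D X₀ ⟨y, κ⟩ = D (fun b => Y' b - X₀ b) ⟨y, κ⟩ := by rw [hDlin]
  have hsup : ‖D (fun b => Y' b - X₀ b) ⟨y, κ⟩‖ ≤ Λ * (ℓ * c₀) := hD _ _ hY' _
  calc _ = ‖(((Ubar ⟨y, μ⟩ : Matrix.specialUnitaryGroup (Fin N) ℂ) : Matrix (Fin N) (Fin N) ℂ) * D X₀ ⟨y.shift μ, κ⟩ *
            star ((Ubar ⟨y, μ⟩ : Matrix.specialUnitaryGroup (Fin N) ℂ) : Matrix (Fin N) (Fin N) ℂ) - D Y' ⟨y, κ⟩) + (D Y' ⟨y, κ⟩ - D X₀ ⟨y, κ⟩)‖ := by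
          congr 1; abel
    _ ≤ β + Λ * (ℓ * c₀) := (norm_add_le _ _).trans (add_le_add (hcov κ) (by rw [hlin]; exact hsup))

end Step

/-! ## §2 Word-oscillations of `D X₀` and of the datum `X_l` -/

section Words

/-- ★★ **THE WORD-OSCILLATION OF THE COMPOSITE IMAGE** (§1 + ✓p839768 `wordOsc_of_step`): `≤ |w̄|·(β + Λ·(ℓ·c₀))`. [cite: Balaban1985Averaging, Prop. 4 (128)-(131) pp.37-38] -/
theorem wordOsc_of_compositeLetters (Ubar : GaugeField P l (Matrix.specialUnitaryGroup (Fin N) ℂ))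
    (D : (PBond P j → Matrix (Fin N) (Fin N) ℂ) → (PBond P l → Matrix (Fin N) (Fin N) ℂ)) (X₀ : PBond P j → Matrix (Fin N) (Fin N) ℂ) {Λ β ℓ c₀ : ℝ}
    (hDlin : ∀ Y Y' : PBond P j → Matrix (Fin N) (Fin N) ℂ, D (fun b => Y b - Y' b) = fun c => D Y c - D Y' c)
    (hD : ∀ (Y : PBond P j → Matrix (Fin N) (Fin N) ℂ) (s : ℝ), (∀ b, ‖Y b‖ ≤ s) → ∀ c, ‖D Y c‖ ≤ Λ * s)
    (hDcov : ∀ (y : Site P l) (μ : Fin P.d), ∃ Y' : PBond P j → Matrix (Fin N) (Fin N) ℂ, (∀ b, ‖Y' b - X₀ b‖ ≤ ℓ * c₀) ∧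
      ∀ κ : Fin P.d, ‖((Ubar ⟨y, μ⟩ : Matrix.specialUnitaryGroup (Fin N) ℂ) : Matrix (Fin N) (Fin N) ℂ) * D X₀ ⟨y.shift μ, κ⟩ *
          star ((Ubar ⟨y, μ⟩ : Matrix.specialUnitaryGroup (Fin N) ℂ) : Matrix (Fin N) (Fin N) ℂ) - D Y' ⟨y, κ⟩‖ ≤ β)
    (y : Site P l) (w : List (Letter P.d)) (κ : Fin P.d) :
    ‖((holAt Ubar (walk y w) : Matrix.specialUnitaryGroup (Fin N) ℂ) : Matrix (Fin N) (Fin N) ℂ) * D X₀ ⟨walkEnd y w, κ⟩ *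
        star ((holAt Ubar (walk y w) : Matrix.specialUnitaryGroup (Fin N) ℂ) : Matrix (Fin N) (Fin N) ℂ) - D X₀ ⟨y, κ⟩‖ ≤ (w.length : ℝ) * (β + Λ * (ℓ * c₀)) :=
  wordOsc_of_step Ubar (D X₀) (fun y' μ κ' => step_of_compositeLetters Ubar D X₀ hDlin hD hDcov y' μ κ') y w κ

/-- ★★ **THE WORD-OSCILLATION OF THE LEVEL-`l` DATUM** `X_l` within `ρ₂` of `D X₀` (hNL, second order): `≤ |w̄|·(β + Λ·(ℓ·c₀) + 2ρ₂)` (✓p839886 `wordOsc_of_approx`).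
[cite: Balaban1985Averaging, Prop. 4 (128)-(131) pp.37-38] -/
theorem wordOsc_datum_of_compositeLetters (Ubar : GaugeField P l (Matrix.specialUnitaryGroup (Fin N) ℂ))
    (D : (PBond P j → Matrix (Fin N) (Fin N) ℂ) → (PBond P l → Matrix (Fin N) (Fin N) ℂ)) (X₀ : PBond P j → Matrix (Fin N) (Fin N) ℂ)
    (Xl : PBond P l → Matrix (Fin N) (Fin N) ℂ) {Λ β ℓ c₀ ρ₂ : ℝ}
    (hDlin : ∀ Y Y' : PBond P j → Matrix (Fin N) (Fin N) ℂ, D (fun b => Y b - Y' b) = fun c => D Y c - D Y' c)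
    (hD : ∀ (Y : PBond P j → Matrix (Fin N) (Fin N) ℂ) (s : ℝ), (∀ b, ‖Y b‖ ≤ s) → ∀ c, ‖D Y c‖ ≤ Λ * s)
    (hDcov : ∀ (y : Site P l) (μ : Fin P.d), ∃ Y' : PBond P j → Matrix (Fin N) (Fin N) ℂ, (∀ b, ‖Y' b - X₀ b‖ ≤ ℓ * c₀) ∧
      ∀ κ : Fin P.d, ‖((Ubar ⟨y, μ⟩ : Matrix.specialUnitaryGroup (Fin N) ℂ) : Matrix (Fin N) (Fin N) ℂ) * D X₀ ⟨y.shift μ, κ⟩ *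
          star ((Ubar ⟨y, μ⟩ : Matrix.specialUnitaryGroup (Fin N) ℂ) : Matrix (Fin N) (Fin N) ℂ) - D Y' ⟨y, κ⟩‖ ≤ β)
    (hNL : ∀ c, ‖Xl c - D X₀ c‖ ≤ ρ₂)
    (y : Site P l) (w : List (Letter P.d)) (κ : Fin P.d) :
    ‖((holAt Ubar (walk y w) : Matrix.specialUnitaryGroup (Fin N) ℂ) : Matrix (Fin N) (Fin N) ℂ) * Xl ⟨walkEnd y w, κ⟩ *
        star ((holAt Ubar (walk y w) : Matrix.specialUnitaryGroup (Fin N) ℂ) : Matrix (Fin N) (Fin N) ℂ) - Xl ⟨y, κ⟩‖ ≤ (w.length : ℝ) * ((β + Λ * (ℓ * c₀)) + 2 * ρ₂) :=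
  wordOsc_of_approx Ubar Xl (D X₀) (wordOsc_of_compositeLetters Ubar D X₀ hDlin hD hDcov) hNL y w κ

end Words

/-! ## §3 ★★★ C₇b's `hOSC` at level `l`, K-uniform shape -/

section HOSC

/-- ★★★ **(REG-UP)′ IN C₇b's CURRENCY**: under the composite letters (hDlin)(hD)(hDcov)(hNL) at levels `j → l` (`l + 2 ≤ m + K`, `0 ≤ β + Λℓc₀ + 2ρ₂`), for the level-`l` datum `X l` (read as
matrices) and background `Ū`, C₇b ✓p838589's covariant oscillation letter holds with `O = 2·(d·(3L))·(β + Λ·(ℓ·c₀) + 2ρ₂)` — with the K-uniform sup row `Λ = C·Lˡ` and `ℓ = Lˡ`: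
`2(d·3L)·(C·L^{2l}·c₀ + β + 2ρ₂)`, ONE scale factor per level in scale-free units, constant independent of the number of levels — TARGET PROFILES for the consumer's
instantiation: `β, ρ₂ ≤ const·L^{2l}·η²` (module docstring).
[cite: Balaban1985Averaging, (8)-(9) p.18, (22) p.21, Prop. 4 (128)-(135) pp.37-38; Balaban1987RG1, (0.3)-(0.4) pp.252-253] -/
theorem hOSC_of_compositeLetters (hl : l + 1 ≤ P.m + P.K) (hl2 : l + 2 ≤ P.m + P.K) (Ubar : GaugeField P l (Matrix.specialUnitaryGroup (Fin N) ℂ))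
    (D : (PBond P j → Matrix (Fin N) (Fin N) ℂ) → (PBond P l → Matrix (Fin N) (Fin N) ℂ)) (X₀ : PBond P j → Matrix (Fin N) (Fin N) ℂ)
    (Xl : PBond P l → (specialUnitaryLogChart (Fin N)).lie) {Λ β ℓ c₀ ρ₂ : ℝ} (hpos : 0 ≤ (β + Λ * (ℓ * c₀)) + 2 * ρ₂)
    (hDlin : ∀ Y Y' : PBond P j → Matrix (Fin N) (Fin N) ℂ, D (fun b => Y b - Y' b) = fun c => D Y c - D Y' c)
    (hD : ∀ (Y : PBond P j → Matrix (Fin N) (Fin N) ℂ) (s : ℝ), (∀ b, ‖Y b‖ ≤ s) → ∀ c, ‖D Y c‖ ≤ Λ * s)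
    (hDcov : ∀ (y : Site P l) (μ : Fin P.d), ∃ Y' : PBond P j → Matrix (Fin N) (Fin N) ℂ, (∀ b, ‖Y' b - X₀ b‖ ≤ ℓ * c₀) ∧
      ∀ κ : Fin P.d, ‖((Ubar ⟨y, μ⟩ : Matrix.specialUnitaryGroup (Fin N) ℂ) : Matrix (Fin N) (Fin N) ℂ) * D X₀ ⟨y.shift μ, κ⟩ *
          star ((Ubar ⟨y, μ⟩ : Matrix.specialUnitaryGroup (Fin N) ℂ) : Matrix (Fin N) (Fin N) ℂ) - D Y' ⟨y, κ⟩‖ ≤ β)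
    (hNL : ∀ c, ‖((Xl c : (specialUnitaryLogChart (Fin N)).lie) : Matrix (Fin N) (Fin N) ℂ) - D X₀ c‖ ≤ ρ₂)
    {μ ν : Fin P.d} (y' : Site P (l + 1)) (b b' : PBond P l)
    (hb : blockOf b.src = y' ∨ blockOf b.src = y'.shift μ ∨ blockOf b.src = y'.shift ν ∨ blockOf b.src = (y'.shift μ).shift ν)
    (hb' : blockOf b'.src = y' ∨ blockOf b'.src = y'.shift μ ∨ blockOf b'.src = y'.shift ν ∨ blockOf b'.src = (y'.shift μ).shift ν)
    (hdir : b.dir = b'.dir) :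
    ‖((axialGauge Ubar (fun κ : Fin P.d => (((emb y' κ).val : ℕ) : ℤ) - (((P.L - 1) / 2 : ℕ) : ℤ)) (fun κ : Fin P.d => (((emb y' κ).val : ℕ) : ℤ) + (((if κ = μ then (P.L : ℤ) else 0) + (if κ = ν then (P.L : ℤ) else 0)) + (((P.L - 1) / 2 : ℕ) : ℤ)) + 1) b.src : Matrix.specialUnitaryGroup (Fin N) ℂ) : Matrix (Fin N) (Fin N) ℂ) * ((Xl b : (specialUnitaryLogChart (Fin N)).lie) : Matrix (Fin N) (Fin N) ℂ) * star ((axialGauge Ubar (fun κ : Fin P.d => (((emb y' κ).val : ℕ) : ℤ) - (((P.L - 1) / 2 : ℕ) : ℤ)) (fun κ : Fin P.d => (((emb y' κ).val : ℕ) : ℤ) + (((if κ = μ then (P.L : ℤ) else 0) + (if κ = ν then (P.L : ℤ) else 0)) + (((P.L - 1) / 2 : ℕ) : ℤ)) + 1) b.src : Matrix.specialUnitaryGroup (Fin N) ℂ) : Matrix (Fin N) (Fin N) ℂ) -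
      ((axialGauge Ubar (fun κ : Fin P.d => (((emb y' κ).val : ℕ) : ℤ) - (((P.L - 1) / 2 : ℕ) : ℤ)) (fun κ : Fin P.d => (((emb y' κ).val : ℕ) : ℤ) + (((if κ = μ then (P.L : ℤ) else 0) + (if κ = ν then (P.L : ℤ) else 0)) + (((P.L - 1) / 2 : ℕ) : ℤ)) + 1) b'.src : Matrix.specialUnitaryGroup (Fin N) ℂ) : Matrix (Fin N) (Fin N) ℂ) * ((Xl b' : (specialUnitaryLogChart (Fin N)).lie) : Matrix (Fin N) (Fin N) ℂ) * star ((axialGauge Ubar (fun κ : Fin P.d => (((emb y' κ).val : ℕ) : ℤ) - (((P.L - 1) / 2 : ℕ) : ℤ)) (fun κ : Fin P.d => (((emb y' κ).val : ℕ) : ℤ) + (((if κ = μ then (P.L : ℤ) else 0) + (if κ = ν then (P.L : ℤ) else 0)) + (((P.L - 1) / 2 : ℕ) : ℤ)) + 1) b'.src : Matrix.specialUnitaryGroup (Fin N) ℂ) : Matrix (Fin N) (Fin N) ℂ)‖ ≤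
      2 * ((P.d : ℝ) * ((3 * P.L : ℕ) : ℝ)) * ((β + Λ * (ℓ * c₀)) + 2 * ρ₂) := by
  have hw := wordOsc_datum_of_compositeLetters Ubar D X₀ (fun c => ((Xl c : (specialUnitaryLogChart (Fin N)).lie) : Matrix (Fin N) (Fin N) ℂ)) hDlin hD hDcov hNL
  have hz := zdWordOsc_of_torusWordOsc Ubar (fun c => ((Xl c : (specialUnitaryLogChart (Fin N)).lie) : Matrix (Fin N) (Fin N) ℂ)) hw
  exact hOSC_of_wordOscillation hl hl2 Ubar (fun c => ((Xl c : (specialUnitaryLogChart (Fin N)).lie) : Matrix (Fin N) (Fin N) ℂ)) hpos hz y' b b' hb hb' hdir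

end HOSC

end Summit.QuantumFields.YangMills.Theorems.FluctuationComparisonRegPrIntLS2BetaCovariantOscillationKUniform

end
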